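import Summits.ABC.ABC.Theses.TwistAmplification
import Summits.ABC.ABC.Theorems.TwistAmplificationMazurKaneLawToolkitDefs
import Summits.ABC.ABC.Theorems.TwistAmplificationMazurKaneLawShapeTransfer
import Summits.ABC.ABC.Theorems.TwistAmplificationMazurKaneLawDetTool
import Summits.ABC.ABC.Theorems.TwistAmplificationMazurKaneLawToolkitTame
import Summits.ABC.ABC.Theorems.TwistAmplificationMazurKaneLawSqrtLatticeDefs
import Summits.ABC.ABC.Theorems.TwistAmplificationMazurKaneLawSqrtLatticeToolX
import Summits.ABC.ABC.Theorems.TwistAmplificationMazurKaneLawSqrtLatticeToolZ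
import Summits.ABC.ABC.Theorems.TwistAmplificationMazurKaneLawToolkitCertifiedLaw

/-!
# Skeleton line `fibre-toolkit-lp-wall-map` for crux `MazurKaneLaw` (stmt-ABC-2757) — lead v3.2 (c2: record pipeline v2 landed)

LEAD c2 (prover-line-stmt-ABC-2757-c2-0, 2026-08-16; continuation seat c2). The composition below is UNCHANGED from v3.1 (the crux
still follows from the two registered open stubs `wallResidualPlus` [5/3,2) and `deepResidualPlus` (1,5/3) by name); what c2 adds
lives entirely on the RECORD side of the line, where the kit's exact linear programme is now certified generically:

* RECORD PIPELINE v2: `recordInstance_of_lp` (…RecordDictionary.lean, p118307) proves the exponent dictionary ONCE for every number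
  `J` of explicit levels (LP telescope over `a b c : Fin J → ℝ`, the five tool families quantified over finsets of `Fin J`); the slack-
  coefficient variant `RecordInstanceK` (…RecordFineDefs.lean p119193, `recordInstanceK_of_lp` p119498, `shapeCount_le_of_recordInstanceK`
  p119572) removes the 1.5e-3 certification margin of the `K = 1` form. Certificates are generated (own exact B&B over the disjunctive
  tools, product-rule strong branching, every `linarith` leaf on its exactly re-verified dual support; lp/ of the proving session).
* RECORDS LANDED: abc hits `≪ X^{3/5+ε}` (`abcHitCount_le_rpow_three_fifths`, …RecordsV2.lean p118886); `RecordAt s₀ ((23 s₀+1)/40)` for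
  all `s₀ ∈ [1,5/3]` (BBLT's `(23λ+3)/40` lowered by `1/20` uniformly), `RecordAt (5/3) (24/25)`, `RecordAt s₀ (4 s₀/5 − 2107/5000)` on
  `[7/4,16/9]` (…RecordsV3.lean p119374); in flight (…RecordsV4.lean): abc hits `≪ X^{7/12+ε}` (`lp_R7`, J = 7, K = 3; the kit's exact value
  at `s = 1` is `67/115`, stable from J = 7 on) and `RecordAt s₀ (4 s₀/5 − 19/45)` on `[7/4,16/9]` ⟹ a power saving below Kane for EVERY
  `s < 16/9`.
* RESIDUE: the kit's exact value is `1` from `s = 16/9` on (maximiser at 16/9: `(2/9,2/9,1/9)² × (1/3,1/3)`, i.e. the conic families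
  R(δ,1)/R(δ,2) of v3.1); unwinding them the missing input is a mean-value bound for bilinear forms in Kloosterman-type FRACTIONS
  `c (x″/x′)² / x²` with SQUARE moduli at the critical length (`x′, x″ ~ x N^{−δ/2} < √modulus`; q-vdC cannot start, Baier–Zhao loses
  `N^{1/6}`) — Duke–Friedlander–Iwaniec type, = `stub_nearWall` of line `critical-kloosterman-powerful-moduli`. A proximity tool for
  lopsided data (k-th roots in a short interval) was tested in the LP and changes no value. So `wallResidualPlus` restricted to
  `[16/9, 2)` is the honest crux-sized residue of this line; below `16/9` the line's output is the certified record curve.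

v3.1 header (lead c1) follows.

# Skeleton line `fibre-toolkit-lp-wall-map` for crux `MazurKaneLaw` (stmt-ABC-2757) — lead v3.1 (wave 1 landed)

Lead prover-line-stmt-ABC-2757-c1-0, 2026-08-16 (continuation seat c1). v1 = the crux-plan skeleton (planner, 5 stubs);
v2 = lead -1's reshape after S1–S3 landed (p81007 shapeTransfer, p85418 detTool, p87671 toolkitTame): crux ⟸
wallResidual ∧ deepResidual over `Wild = ¬Tame`. v3 = THIS FILE: one new fibre tool is added to the kit and the residue
shrinks accordingly.

THE SQUARE-ROOT LATTICE TOOL `Q(t; H; k)` (new; stubs S6 `sqrtLatticeToolX`, S7 `sqrtLatticeToolZ`, provable now, size L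
each): host term `t` with freed coordinate set `H`, and the level-`k` variables `y, z` (`k = i + 1 ≥ 2`) of the two OTHER
terms freed. In a counted solution `F·m + B yᵏ = C zᵏ` (`F` = frozen host cofactor) coprimality inside the abc triple makes
`y, z, B, C` units mod `F`, so `z ≡ λ y (mod F)` for one of `≤ #μₖ(ℤ/F) ≤ Dτ^{k+1}` root classes `λ`
(`natCard_rootsOfUnity_le_pow`, landed with S2), and `gcd(y, z) = 1`, so the tree's PRIMITIVE congruence-lattice count
`card_box_filter_coprime_congr_le` gives `≤ 2 + 112 YᵢZᵢ/F` per class — no successive-minimum term; `(y, z)` determines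
`m`, hence `x_H` up to `Dτ^d`. Multiplicatively `B ≤ #fibres · Dτ^{d+k+1} · (2 + 112 YᵢZᵢ/(c_t offVal_H))`; in exponents
`D ≤ max(L − W_t + Σ_{j∈H} j·m_{t,j}, L − Σ_{j∈H} m_{t,j} − m_{t′,k} − m_{t″,k})`. It contains drefute-g2's ROOT TOOL
(`Cruxes/MazurKaneLaw/RootTool.lean`) and coincides at `H = {0}, k = 2` with the TWO-ROOT TOOL R₂ that the concurrent lead
-2 registered on line `critical-kloosterman-powerful-moduli` (`stub_twoRootTameX/Z`, 10:34Z) — convergent discovery; the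
forms here are the general multiplicative ones the exponent dictionary consumes.

S8 `toolkitCertifiedLaw` (provable now, L; generalises S3): with DetTool and the two Q tools, data certified⁺ at `θ + η/2`
obey `B ≤ K C₀^{θ+η}` for EVERY real `θ` (`BoxLawAt (TameAt θ) s θ`; the proof of S3 never used `θ = s − 1`). At
`θ = s − 1` this is the law on `TamePlus`; at `θ = V(s)` it is what a certified record exponent needs.

CONSEQUENCE (`MazurKaneLaw_of`, kernel-checked below): the crux follows from the box law on the WILD⁺ boxes alone —
`wallResidualPlus` (`s ∈ [5/3,2)`) and `deepResidualPlus` (`s ∈ (1,5/3)`), `WildPlus = ¬(Tame ∨ Q-certified) ⊆ Wild`.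
What Q removes from the v2 residue: the asymmetric walls (at the law) and the "spread" family that held the kit+R plateau
at value 1 (s = 1.85, L = 1.8: a = u w³ (.4,.2), b = u′x² (.2,.4), c = u″y² (.2,.4): `Q(a;{0};2)` gives .8 < .85). What it
does NOT remove (value 1 against the law 1 − δ at s = 2 − δ, every δ ∈ (0, 1/4]): the family R(δ,1) `a = u x² w³`
(u ≍ x ≍ N^{1/3−δ}, w ≍ N^δ), `b = u′x′²`, `c = u″x″²` (all ≍ N^{1/3}) — a family of N conics
`u″X² − u′Y² = (u w³)Z²` probed at `N^{−δ}` × Holzer's bound in every coordinate, i.e. exactly a SUB-HOLZER DENSITY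
statement (cf. line `peyre-level-torsor-v22`, `LevelTorsorBound`); and the symmetric wall `u x² w³` ×3 (mixed lattice:
1 − (2−s)/3). So `wallResidualPlus` stays open and the plateau of the enlarged kit is `[7/4, 2)` (R(δ,1) is Fourier-tame
iff δ > 1/4); on `(1, 7/4)` the kit+Q value `V⁺(s) < 1` is a certified-record target (support theorems via S8).

WAVE 1 (all landed, --supports stmt-ABC-2757): S6 sqrtLatticeToolX p98709 (Theorems/…SqrtLatticeToolX.lean), S7
sqrtLatticeToolZ p100503 (…SqrtLatticeToolZ.lean), S8 toolkitCertifiedLaw p102234 (…ToolkitCertifiedLaw.lean), Defs p97226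
(…SqrtLatticeDefs.lean). EXACT LP of the kits (lead, lp/findv2.py, pure-python B&B + separation, reproduces drefute-g2's
kit2 table to 4 digits): V⁺ = V_{kit+Q}(s) = .609 (1.05) .638 (1.1) .691 (1.2) .749 (1.3) .767 (4/3) .803 (1.4) .862 (1.5) .929 (1.6)
.957 (5/3) .972 (1.7) .978 (12/7…1.75) .984 (1.76) .993 (1.77) 1 (≥ 16/9); plateau [16/9,2) held by R(δ,2): a = u x² (1/3,1/3),
b = c = u x² w³ (1/3−δ/2, 1/3−δ/2, δ/2) (value 1: Det₂/Kane/Q all tie), and on [11/6,2) also by R(δ,1); V⁺ < min(1,(23s+3)/40)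
on all of (1,16/9).

REGISTRATION: the five v3 stubs are registered on the crux item by `ledger workitem stub-add` (names + signatures below,
verbatim) and NOT by `ledger skeleton check`, because a skeleton registration expires every skeleton-registered stub not in
the new file — it would have expired the six live stubs of the concurrent lead -2 (`critical_kloosterman_powerful_moduli.lean`,
skeleton 2d9db368c235). The vocabulary block `namespace Summit.ABC.ABC.Theorems.MazurKaneLaw.Toolkit … end` below is a
byte-copy of the proposed Defs file `Theorems/TwistAmplificationMazurKaneLawSqrtLatticeDefs.lean` (p-id in NOTES.md); when it
lands this block is replaced by the import.

Disproof.lean (cdisprove, crux dir copy 05:26Z) honoured as in v1/v2: `+η` everywhere (`not_lawAt_zero`,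
`abcExponentCount_not_bigO`), coprimality USED by Q (units mod F, `gcd(y,z)=1`), `1 < s` used in S1; no `-- Targets` section
names a v3 stub; no `Negative/` lemma has landed for this crux.
-/

noncomputable section

-- `Summit.<Summit>.<Problem>` is the mandated summit-side namespace; for the single-conjunct summit `ABC` the duplicate
-- `ABC.ABC` is deliberate (the lakefile sets the same option tree-wide).
set_option linter.dupNamespace false

open Finset
open Literature.NumberTheory.DiophantineGeometry
open Literature.NumberTheory.DiophantineGeometry.AbcShapes

/-! ## v3 vocabulary: `Theorems/TwistAmplificationMazurKaneLawSqrtLatticeDefs.lean` (landed p97226) -/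

open Summit.ABC.ABC.Theorems.MazurKaneLaw.Toolkit

namespace Summit.ABC.ABC.Cruxes.MazurKaneLaw.FibreToolkitLpWallMap

/-! ### The two remaining registered stubs `Stub.<name>` (`sorry` lives only here; signatures verbatim as registered by
`ledger workitem stub-add stmt-ABC-2757 --name <name> --signature …`, fully qualified, `let`-free; S6–S8 were stated the same way
and are now the landed theorems `Summit.ABC.ABC.Theorems.MazurKaneLaw.{sqrtLatticeToolX, sqrtLatticeToolZ, toolkitCertifiedLaw}`) -/

namespace Stub

/-- STUB S4⁺ `wallResidualPlus` (XL, OPEN — the line's TARGET; held by the lead): for `s ∈ [5/3, 2)` the WILD⁺ boxes obey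
the law. Known content at value 1 on `[7/4,2)`: the conic family R(δ,1) (sub-Holzer density) and the symmetric wall. -/
theorem wallResidualPlus : ∀ s : ℝ, 5 / 3 ≤ s → s < 2 → Summit.ABC.ABC.Theorems.MazurKaneLaw.Toolkit.BoxLawOn Summit.ABC.ABC.Theorems.MazurKaneLaw.Toolkit.WildPlus s := by
  sorry

/-- STUB S5⁺ `deepResidualPlus` (XL⁺, OPEN, HARDEST — not attacked; PROMOTION CANDIDATE): `s ∈ (1, 5/3)`. -/
theorem deepResidualPlus : ∀ s : ℝ, 1 < s → s < 5 / 3 → Summit.ABC.ABC.Theorems.MazurKaneLaw.Toolkit.BoxLawOn Summit.ABC.ABC.Theorems.MazurKaneLaw.Toolkit.WildPlus s := by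
  sorry

end Stub

/-! ### The landed v1/v2 stubs, by name -/

/-- S1 (landed p81007): the transfer `C⁺ → crux`. -/
theorem shapeTransfer_holds : ShapeTransfer := fun h =>
  Summit.ABC.ABC.Theorems.MazurKaneLaw.shapeTransfer fun s hs1 hs2 => (boxLawOn_everywhere_iff s).1 (h s hs1 hs2)

/-- S2 (landed p85418): the determinant tool. -/
theorem detTool_holds : DetTool := Summit.ABC.ABC.Theorems.MazurKaneLaw.detTool

/-- S3 (landed p87671): tame boxes obey the law (now a corollary of S8, kept for the record). -/
theorem toolkitTame_holds : ToolkitTame := Summit.ABC.ABC.Theorems.MazurKaneLaw.toolkitTame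

/-- S6 (landed p98709): the square-root lattice tool, host `x`. -/
theorem sqrtLatticeToolX_holds : SqrtLatticeToolX := Summit.ABC.ABC.Theorems.MazurKaneLaw.sqrtLatticeToolX

/-- S7 (landed p100503): the square-root lattice tool, host `z`. -/
theorem sqrtLatticeToolZ_holds : SqrtLatticeToolZ := Summit.ABC.ABC.Theorems.MazurKaneLaw.sqrtLatticeToolZ

/-- S8 (landed p102234): certified⁺ data obey the law at every exponent `θ`. -/
theorem toolkitCertifiedLaw_holds : ToolkitCertifiedLaw := Summit.ABC.ABC.Theorems.MazurKaneLaw.toolkitCertifiedLaw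

/-- S4⁺ IS its registered stub (definitionally). -/
theorem wallResidualPlus_holds : WallResidualPlus := Stub.wallResidualPlus

/-- S5⁺ IS its registered stub (definitionally). -/
theorem deepResidualPlus_holds : DeepResidualPlus := Stub.deepResidualPlus

/-! ### Name-keyed aliases of the open/provable statements (the hypotheses of the composition) -/
namespace Registered

/-- Alias of `WallResidualPlus` keyed by the registered stub name (OPEN). -/
abbrev wallResidualPlus : Prop := WallResidualPlus
/-- Alias of `DeepResidualPlus` keyed by the registered stub name (OPEN). -/
abbrev deepResidualPlus : Prop := DeepResidualPlus

end Registered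

/-! ### Glue (proved) -/

/-- The tame⁺ law at `s` from S8 at `θ = s − 1` (definitional: `TamePlus = TameAt (s - 1)`, `BoxLawOn = BoxLawAt _ _ (s-1)`). -/
theorem boxLawOn_tamePlus (h8 : ToolkitCertifiedLaw) (hD : DetTool) (h6 : SqrtLatticeToolX) (h7 : SqrtLatticeToolZ)
    (s : ℝ) : BoxLawOn TamePlus s :=
  (boxLawOn_iff_boxLawAt TamePlus s).2 (h8 hD h6 h7 s (s - 1))

/-- On a common range of `ε′`, the law on the tame⁺ boxes and the law on the wild⁺ boxes give the law on every admissible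
box (case split `tamePlus_or_wildPlus`, constants added). -/
theorem boxLawOn_everywhere_of_tamePlus_wildPlus {s : ℝ} (ht : BoxLawOn TamePlus s) (hw : BoxLawOn WildPlus s) :
    BoxLawOn Everywhere s := by
  intro η hη
  obtain ⟨ε₁, hε₁, h₁⟩ := ht η hη
  obtain ⟨ε₂, hε₂, h₂⟩ := hw η hη
  refine ⟨min ε₁ ε₂, lt_min hε₁ hε₂, fun ε' hε' hle => ?_⟩
  obtain ⟨K₁, hK₁, hB₁⟩ := h₁ ε' hε' (hle.trans (min_le_left _ _))
  obtain ⟨K₂, hK₂, hB₂⟩ := h₂ ε' hε' (hle.trans (min_le_right _ _))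
  refine ⟨K₁ + K₂, by positivity, fun C₀ c₁ c₂ c₃ X Y Z hA _ => ?_⟩
  have hC : (0 : ℝ) ≤ (C₀ : ℝ) ^ (s - 1 + η) := by positivity
  have h1C : 0 ≤ K₁ * (C₀ : ℝ) ^ (s - 1 + η) := mul_nonneg hK₁ hC
  have h2C : 0 ≤ K₂ * (C₀ : ℝ) ^ (s - 1 + η) := mul_nonneg hK₂ hC
  rcases tamePlus_or_wildPlus (numShapes ε') s (η / 2) C₀ c₁ c₂ c₃ X Y Z with hT | hW
  · calc (shapeCount c₁ c₂ c₃ X Y Z : ℝ) ≤ K₁ * (C₀ : ℝ) ^ (s - 1 + η) := hB₁ C₀ c₁ c₂ c₃ X Y Z hA hT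
      _ ≤ (K₁ + K₂) * (C₀ : ℝ) ^ (s - 1 + η) := by linarith [add_mul K₁ K₂ ((C₀ : ℝ) ^ (s - 1 + η))]
  · calc (shapeCount c₁ c₂ c₃ X Y Z : ℝ) ≤ K₂ * (C₀ : ℝ) ^ (s - 1 + η) := hB₂ C₀ c₁ c₂ c₃ X Y Z hA hW
      _ ≤ (K₁ + K₂) * (C₀ : ℝ) ^ (s - 1 + η) := by linarith [add_mul K₁ K₂ ((C₀ : ℝ) ^ (s - 1 + η))]

/-! ### The composition: the two open stubs imply the crux, by name (S1, S2, S6, S7, S8 discharged by the landed theorems) -/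

/-- **`MazurKaneLaw_of`** — the crux from the two REGISTERED OPEN stubs `wallResidualPlus` (S4⁺) and `deepResidualPlus` (S5⁺)
alone: the landed S8 fed with the landed S2, S6, S7 gives the law on tame⁺ boxes at every `s`; S4⁺ (`s ≥ 5/3`) or S5⁺ (`s < 5/3`)
the law on wild⁺ boxes; the glue the law on all admissible boxes; the landed S1 transfers the box laws at all `s′ ∈ (1, 2)` to the
crux. Pure composition; no `sorry` here. -/
theorem MazurKaneLaw_of (h4 : Registered.wallResidualPlus) (h5 : Registered.deepResidualPlus) :
    Summit.ABC.ABC.Theses.TwistAmplification.MazurKaneLaw := by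
  refine shapeTransfer_holds fun s hs1 hs2 => ?_
  have ht : BoxLawOn TamePlus s :=
    boxLawOn_tamePlus toolkitCertifiedLaw_holds detTool_holds sqrtLatticeToolX_holds sqrtLatticeToolZ_holds s
  have hw : BoxLawOn WildPlus s := by
    rcases le_or_gt (5 / 3 : ℝ) s with h | h
    · exact h4 s h hs2
    · exact h5 s hs1 h
  exact boxLawOn_everywhere_of_tamePlus_wildPlus ht hw

/-- **The skeleton**: the crux modulo exactly the two remaining registered stubs `Stub.wallResidualPlus`, `Stub.deepResidualPlus`. -/
theorem MazurKaneLaw_proof : Summit.ABC.ABC.Theses.TwistAmplification.MazurKaneLaw :=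
  MazurKaneLaw_of Stub.wallResidualPlus Stub.deepResidualPlus

/-- The wild⁺ residue is contained in the v2 residue: the v2 stubs imply the v3 ones (so v3 asks for no more than v2). -/
theorem wallResidualPlus_of_v2 (h : ∀ s : ℝ, 5 / 3 ≤ s → s < 2 → BoxLawOn Wild s) : WallResidualPlus := by
  intro s hs1 hs2 η hη
  obtain ⟨ε₀, hε₀, h₀⟩ := h s hs1 hs2 η hη
  refine ⟨ε₀, hε₀, fun ε' hε' hle => ?_⟩
  obtain ⟨K, hK, hB⟩ := h₀ ε' hε' hle
  exact ⟨K, hK, fun C₀ c₁ c₂ c₃ X Y Z hA hW => hB C₀ c₁ c₂ c₃ X Y Z hA (wild_of_wildPlus hW)⟩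

end Summit.ABC.ABC.Cruxes.MazurKaneLaw.FibreToolkitLpWallMap

end
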